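import Mathlib.NumberTheory.NumberField.Completion.InfinitePlace
import Mathlib.Analysis.Real.Sqrt
import Literature.NumberTheory.Automorphic.QuaternionRamificationParity
import Literature.NumberTheory.Automorphic.QuaternionAlgebraAdelicNormSqProofs
import Literature.NumberTheory.Automorphic.QuaternionAlgebraAdelicReducedNormMulProofs
import Literature.NumberTheory.Automorphic.QuaternionAlgebraAdelicReducedNormProofs
import HarnessLib

/-!
# Totally definite quaternion algebras over `ℚ`: `D ≃ ℍ[ℚ,a,b]` with `a, b < 0`, and `nrd > 0`

Topic `NumberTheory/Automorphic`; theorems only. For a quaternion algebra `D` over `ℚ` which is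
**totally definite** in the sense of the tree (`IsTotallyDefinite ℚ D`: not split at the infinite
place, `Literature/NumberTheory/Automorphic/QuaternionAlgebraAdelic.lean`) we prove the classical
description (Vignéras, LNM 800, Ch. I §1 and Ch. III §3; Voight, GTM 288, §2.4 and 14.5.7):

* `neg_and_neg_of_forall_sq_sub_mul_sq_ne` : if `x² - a y² = b` (`a b ≠ 0`) has no real solution
  then `a < 0` and `b < 0` (real square roots);
* `exists_algEquiv_quaternionAlgebra_of_isTotallyDefinite` : `D ≃ₐ[ℚ] ℍ[ℚ,a,b]` for some
  `a < 0`, `b < 0` (from the tree's `IsQuaternionAlgebra.exists_algEquiv_quaternionAlgebra`,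
  `isSplitAtInfinite_congr`, `isSplitAtInfinite_quaternionAlgebra_iff` and Mathlib's
  `InfinitePlace.Completion.ringEquivRealOfIsReal` for the real place of `ℚ`);
* `QuaternionAlgebra.reducedNorm_eq_sum_sq` and the coordinate bounds `sq_re_le_reducedNorm`, … :
  for `a, b < 0` the reduced norm `nrd = x₀² + |a| x₁² + |b| x₂² + ab x₃²` is a positive definite
  diagonal form dominating each squared coordinate;
* `reducedNorm_pos_of_isTotallyDefinite`, `isUnit_of_isTotallyDefinite` : on a totally definite
  `D` over `ℚ`, `nrd(x) > 0` for `x ≠ 0`; in particular `D` is a division algebra.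

Written as infrastructure for the finiteness of unit groups of orders in such `D` (positivity of the
Brandt weights `w_c`, `BrandtWeightPos.lean`; Pollack–Weston 2011 §2.1 / Gross 1987 §1), itself a
by-product of the audit of `PollackWeston2011.thm_6_8_ellipticCurve` (triaged XL, not discharged).

## References

* M.-F. Vignéras, *Arithmétique des algèbres de quaternions*, LNM 800 (1980), Ch. I §1 (norm
  form of `{a, b}`), Ch. III §3 (ramification at real places) [VignerasLNM800].
* J. Voight, *Quaternion Algebras*, GTM 288 (2021), §2.4, 14.5.7 (definite algebras) [Voight2021].
-/

noncomputable section

open NumberField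
open scoped Quaternion

universe u

namespace Literature.NumberTheory.Automorphic

/-! ### A real lemma -/

/-- If `b = x² - a y²` has no real solution (`a ≠ 0`), then `a < 0` and `b < 0`: otherwise
`(√b, 0)` or `(0, √(-b/a))` solves it. [folklore] -/
theorem neg_and_neg_of_forall_sq_sub_mul_sq_ne {a b : ℝ} (ha : a ≠ 0)
    (h : ∀ x y : ℝ, x ^ 2 - a * y ^ 2 ≠ b) : a < 0 ∧ b < 0 := by
  have hb : b < 0 := by
    by_contra hge
    have hpos : 0 ≤ b := not_lt.mp hge
    exact h (Real.sqrt b) 0 (by rw [Real.sq_sqrt hpos]; ring)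
  refine ⟨?_, hb⟩
  by_contra hge
  have hapos : 0 < a := lt_of_le_of_ne (not_lt.mp hge) (Ne.symm ha)
  have hq : 0 ≤ -b / a := div_nonneg (by linarith) hapos.le
  refine h 0 (Real.sqrt (-b / a)) ?_
  rw [Real.sq_sqrt hq]
  field_simp
  ring

/-! ### Totally definite over `ℚ` means `D ≃ ℍ[ℚ,a,b]` with `a, b < 0` -/

section Rat

variable (D : Type u) [Ring D] [Algebra ℚ D] [IsQuaternionAlgebra ℚ D]

/-- **A totally definite quaternion algebra over `ℚ` is `ℍ[ℚ,a,b]` with `a < 0` and `b < 0`**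
(Vignéras III §3 with I §1: `{a, b}` is ramified at the real place iff `X² - aY² = b` is insoluble
in `ℝ` iff `a, b < 0`; Voight 14.5.7). [cite: VignerasLNM800, Ch. III §3 and Ch. I §2 Cor. 2.4] -/
theorem exists_algEquiv_quaternionAlgebra_of_isTotallyDefinite (hdef : IsTotallyDefinite ℚ D) :
    ∃ a b : ℚ, a < 0 ∧ b < 0 ∧ Nonempty (D ≃ₐ[ℚ] ℍ[ℚ,a,b]) := by
  obtain ⟨a, b, ha, hb, ⟨e⟩⟩ := IsQuaternionAlgebra.exists_algEquiv_quaternionAlgebra ℚ D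
  have hns := hdef Rat.infinitePlace
  rw [isSplitAtInfinite_congr ℚ D e, isSplitAtInfinite_quaternionAlgebra_iff ℚ ha hb] at hns
  set φ := InfinitePlace.Completion.ringEquivRealOfIsReal Rat.isReal_infinitePlace with hφ
  have hφa : ∀ q : ℚ, φ (algebraMap ℚ _ q) = (q : ℝ) := fun q =>
    eq_ratCast (φ.toRingHom.comp (algebraMap ℚ Rat.infinitePlace.Completion)) q
  have hreal : ∀ x y : ℝ, x ^ 2 - (a : ℝ) * y ^ 2 ≠ (b : ℝ) := by
    intro x y hxy
    refine hns ⟨φ.symm x, φ.symm y, φ.injective ?_⟩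
    rw [map_sub, map_mul, map_pow, map_pow, φ.apply_symm_apply, φ.apply_symm_apply, hφa, hφa]
    exact hxy
  obtain ⟨ha', hb'⟩ :=
    neg_and_neg_of_forall_sq_sub_mul_sq_ne (a := (a : ℝ)) (by exact_mod_cast ha) hreal
  exact ⟨a, b, by exact_mod_cast ha', by exact_mod_cast hb', ⟨e⟩⟩

end Rat

/-! ### The norm form of `ℍ[ℚ,a,b]` for `a, b < 0` -/

namespace QuaternionAlgebra

variable {a b : ℚ}

/-- `nrd(x) = x₀² + (-a) x₁² + (-b) x₂² + (ab) x₃²` on `ℍ[ℚ,a,b]` (Vignéras I §1, p. 3: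
`n(h) = x² - ay² - bz² + abt²`). [cite: VignerasLNM800, Ch. I §1 p. 3] -/
theorem reducedNorm_eq_sum_sq (x : ℍ[ℚ,a,b]) :
    reducedNorm ℚ ℍ[ℚ,a,b] x =
      x.re ^ 2 + (-a) * x.imI ^ 2 + (-b) * x.imJ ^ 2 + (a * b) * x.imK ^ 2 := by
  rw [reducedNorm_quaternionAlgebra ℚ a b x]
  ring

variable (ha : a < 0) (hb : b < 0)
include ha hb

/-- For `a, b < 0` the reduced norm of `ℍ[ℚ,a,b]` is non-negative. [folklore] -/
theorem reducedNorm_nonneg (x : ℍ[ℚ,a,b]) : 0 ≤ reducedNorm ℚ ℍ[ℚ,a,b] x := by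
  rw [reducedNorm_eq_sum_sq]
  have h1 : 0 ≤ (-a) * x.imI ^ 2 := mul_nonneg (by linarith) (sq_nonneg _)
  have h2 : 0 ≤ (-b) * x.imJ ^ 2 := mul_nonneg (by linarith) (sq_nonneg _)
  have h3 : 0 ≤ (a * b) * x.imK ^ 2 := mul_nonneg (mul_pos_of_neg_of_neg ha hb).le (sq_nonneg _)
  nlinarith [sq_nonneg x.re]

/-- `x₀² ≤ nrd(x)` for `a, b < 0`. [folklore] -/
theorem sq_re_le_reducedNorm (x : ℍ[ℚ,a,b]) : x.re ^ 2 ≤ reducedNorm ℚ ℍ[ℚ,a,b] x := by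
  rw [reducedNorm_eq_sum_sq]
  have h1 : 0 ≤ (-a) * x.imI ^ 2 := mul_nonneg (by linarith) (sq_nonneg _)
  have h2 : 0 ≤ (-b) * x.imJ ^ 2 := mul_nonneg (by linarith) (sq_nonneg _)
  have h3 : 0 ≤ (a * b) * x.imK ^ 2 := mul_nonneg (mul_pos_of_neg_of_neg ha hb).le (sq_nonneg _)
  linarith

/-- `(-a) x₁² ≤ nrd(x)` for `a, b < 0`. [folklore] -/
theorem mul_sq_imI_le_reducedNorm (x : ℍ[ℚ,a,b]) :
    (-a) * x.imI ^ 2 ≤ reducedNorm ℚ ℍ[ℚ,a,b] x := by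
  rw [reducedNorm_eq_sum_sq]
  have h2 : 0 ≤ (-b) * x.imJ ^ 2 := mul_nonneg (by linarith) (sq_nonneg _)
  have h3 : 0 ≤ (a * b) * x.imK ^ 2 := mul_nonneg (mul_pos_of_neg_of_neg ha hb).le (sq_nonneg _)
  nlinarith [sq_nonneg x.re]

/-- `(-b) x₂² ≤ nrd(x)` for `a, b < 0`. [folklore] -/
theorem mul_sq_imJ_le_reducedNorm (x : ℍ[ℚ,a,b]) :
    (-b) * x.imJ ^ 2 ≤ reducedNorm ℚ ℍ[ℚ,a,b] x := by
  rw [reducedNorm_eq_sum_sq]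
  have h1 : 0 ≤ (-a) * x.imI ^ 2 := mul_nonneg (by linarith) (sq_nonneg _)
  have h3 : 0 ≤ (a * b) * x.imK ^ 2 := mul_nonneg (mul_pos_of_neg_of_neg ha hb).le (sq_nonneg _)
  nlinarith [sq_nonneg x.re]

/-- `(ab) x₃² ≤ nrd(x)` for `a, b < 0`. [folklore] -/
theorem mul_sq_imK_le_reducedNorm (x : ℍ[ℚ,a,b]) :
    (a * b) * x.imK ^ 2 ≤ reducedNorm ℚ ℍ[ℚ,a,b] x := by
  rw [reducedNorm_eq_sum_sq]
  have h1 : 0 ≤ (-a) * x.imI ^ 2 := mul_nonneg (by linarith) (sq_nonneg _)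
  have h2 : 0 ≤ (-b) * x.imJ ^ 2 := mul_nonneg (by linarith) (sq_nonneg _)
  nlinarith [sq_nonneg x.re]

/-- **Positive definiteness**: for `a, b < 0` and `x ≠ 0`, `nrd(x) > 0`. [folklore] -/
theorem reducedNorm_pos {x : ℍ[ℚ,a,b]} (hx : x ≠ 0) : 0 < reducedNorm ℚ ℍ[ℚ,a,b] x := by
  have hna : 0 < -a := by linarith
  have hnb : 0 < -b := by linarith
  have hab : 0 < a * b := mul_pos_of_neg_of_neg ha hb
  rw [reducedNorm_eq_sum_sq]
  have h0 : 0 ≤ x.re ^ 2 := sq_nonneg _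
  have h1 : 0 ≤ (-a) * x.imI ^ 2 := mul_nonneg hna.le (sq_nonneg _)
  have h2 : 0 ≤ (-b) * x.imJ ^ 2 := mul_nonneg hnb.le (sq_nonneg _)
  have h3 : 0 ≤ (a * b) * x.imK ^ 2 := mul_nonneg hab.le (sq_nonneg _)
  by_contra hle
  have hsum : x.re ^ 2 + (-a) * x.imI ^ 2 + (-b) * x.imJ ^ 2 + (a * b) * x.imK ^ 2 = 0 := by
    linarith [not_lt.mp hle]
  have tre : x.re ^ 2 = 0 := by linarith
  have tI : (-a) * x.imI ^ 2 = 0 := by linarith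
  have tJ : (-b) * x.imJ ^ 2 = 0 := by linarith
  have tK : (a * b) * x.imK ^ 2 = 0 := by linarith
  have hre : x.re = 0 := by simpa using tre
  have hI : x.imI = 0 := by simpa using (mul_eq_zero.mp tI).resolve_left hna.ne'
  have hJ : x.imJ = 0 := by simpa using (mul_eq_zero.mp tJ).resolve_left hnb.ne'
  have hK : x.imK = 0 := by simpa using (mul_eq_zero.mp tK).resolve_left hab.ne'
  exact hx (QuaternionAlgebra.ext hre hI hJ hK)

end QuaternionAlgebra

/-! ### Consequences for a totally definite `D` over `ℚ` -/

section Definite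

variable (D : Type u) [Ring D] [Algebra ℚ D] [IsQuaternionAlgebra ℚ D]

/-- **On a totally definite quaternion algebra over `ℚ` the reduced norm is positive definite**:
`nrd(x) > 0` for `x ≠ 0` (transport of `QuaternionAlgebra.reducedNorm_pos` along
`D ≃ ℍ[ℚ,a,b]`, `a, b < 0`; Vignéras III §3, Voight 14.5.7). [cite: VignerasLNM800, Ch. III §3] -/
theorem reducedNorm_pos_of_isTotallyDefinite (hdef : IsTotallyDefinite ℚ D) {x : D} (hx : x ≠ 0) :
    0 < reducedNorm ℚ D x := by
  obtain ⟨a, b, ha, hb, ⟨e⟩⟩ := exists_algEquiv_quaternionAlgebra_of_isTotallyDefinite D hdef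
  rw [← reducedNorm_algEquiv e x]
  exact QuaternionAlgebra.reducedNorm_pos ha hb ((map_ne_zero_iff e e.injective).mpr hx)

/-- On a totally definite quaternion algebra over `ℚ`, `nrd(x) ≥ 0`. [folklore] -/
theorem reducedNorm_nonneg_of_isTotallyDefinite (hdef : IsTotallyDefinite ℚ D) (x : D) :
    0 ≤ reducedNorm ℚ D x := by
  obtain ⟨a, b, ha, hb, ⟨e⟩⟩ := exists_algEquiv_quaternionAlgebra_of_isTotallyDefinite D hdef
  rw [← reducedNorm_algEquiv e x]
  exact QuaternionAlgebra.reducedNorm_nonneg ha hb _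

/-- **A totally definite quaternion algebra over `ℚ` is a division algebra**: every non-zero
element is a unit (`nrd(x) ≠ 0`, tree fact `isUnit_iff_reducedNorm_ne_zero`, discharged).
[cite: VignerasLNM800, Ch. III §3] -/
theorem isUnit_of_isTotallyDefinite (hdef : IsTotallyDefinite ℚ D) {x : D} (hx : x ≠ 0) :
    IsUnit x :=
  (isUnit_iff_reducedNorm_ne_zero_holds ℚ D x).mpr (reducedNorm_pos_of_isTotallyDefinite D hdef hx).ne'

end Definite

end Literature.NumberTheory.Automorphic

end
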